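import Summits.QuantumFields.YangMills.Theses.ParabolicTrajectory
import Literature.MathematicalPhysics.QuantumFieldTheory.BalabanBanachStep
import Summits.QuantumFields.YangMills.Theorems.LatticeGapOnTrajectory.Negative.ZeroCoupling
import Summits.QuantumFields.YangMills.Theorems.ContinuumLimitOnTrajectory.Negative.UltralocalNoLimit
import Summits.QuantumFields.YangMills.Theorems.ContinuumLimitOnTrajectory.Negative.NecessaryConditions

/-!
# Route `ParabolicTrajectory`, crux `ContinuumLimitOnTrajectory` (stmt-QuantumFields-10522): vocabulary of line `two-orbit-synchronisation`

Route-posited objects (D-0016 `<Route><Crux>Defs` file) shared by the registered stubs of the skeleton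
`Cruxes/ContinuumLimitOnTrajectory/Lines/two_orbit_synchronisation.lean` (lead `prover-line-stmt-QuantumFields-10522-0`)
and by the crux work file composing them; VERBATIM the skeleton's declarations (same namespace, so the registered
signatures `stub_sync : TwoOrbitSync`, `stub_chart : ChartExists`, `stub_anatomy : Anatomy`, `stub_volume :
VolumeIndependence`, `stub_limitRegularity : LimitRegularity`, `stub_osLegs : OneFieldOSLegs` are unchanged).
NOTHING here is asserted: every `def … : Prop` is a line statement some registered stub proves or consumes (none is
a literature fact, none restates the crux). §1 one-field vocabulary (`canon` = canonical witness scheme, `c = a⁻⁴`,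
exact centring, other species zeroed; `curvNPoint`, `curvDistribution`, `UVB`, `AsympEuclid`, `ND2`, `ND3`,
`ConvProducts`); §1b the hypothesis structure `TwoOrbitChart G r M` (the card's `BalabanTwoOrbitBounds`: orbitwise,
F-free, infinite-volume chart of Bałaban flows from Wilson points — drift, absorption, the two orbitwise difference
inequalities `marg_diff`/`fibre_diff`, realised `n`-point functions with covariance / thermodynamic identification /
window continuity, the readout `pin`, `uv_small`, `exit_massive`; existence is the stub statement `ChartExists`, not a
field); §2 the six stub statements; §3 two registered elementary glue lemmas of the composition.
Refs: line card `Lines/two-orbit-synchronisation.md`; Balaban1987RG1 (0.18)–(0.20), (0.33); Balaban1988Convergent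
Thm 1/Cor 3; Balaban1989LargeFieldII Thm 1; Dimock2013 §1.2–2.1; OsterwalderSeiler1978 §§2–3.
-/

set_option autoImplicit false

open scoped SchwartzMap
open MeasureTheory Filter Topology
open Literature.MathematicalPhysics.QuantumFieldTheory Literature.MathematicalPhysics.QuantumLattice
open Literature.MathematicalPhysics.AQFT Literature.Probability.LatticeModels
open Summit.QuantumFields.YangMills.Theses.ParabolicTrajectory

noncomputable section

namespace Summit.QuantumFields.YangMills.Cruxes.ContinuumLimitOnTrajectory.TwoOrbitSynchronisation

local notation "𝔼" => EuclideanSpace ℝ (Fin 4)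

section Vocabulary

variable {G : Type} [Group G] [TopologicalSpace G] [IsTopologicalGroup G] [CompactSpace G]
  [MeasurableSpace G] [BorelSpace G]

open Classical in
/-- **Canonical one-field renormalisation** of a scheme: same `(a, β, L)`; the curvature species `tr F²`
(`r.curvature`) gets the canonical dimension-four normalisation `c(k) = a_k⁻⁴` and EXACT centring by the torus
Wilson mean; every other species is renormalised to `0` (legal witness data: Disproof F6/F7 `crux_iff_oneField`). -/
def canon (r : LatticeRep G) (sch : SpeciesScheme (YMSpecies G)) : SpeciesScheme (YMSpecies G) where
  a := sch.a
  a_pos := sch.a_pos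
  tendsto_a := sch.tendsto_a
  β := sch.β
  L := sch.L
  tendsto_L := sch.tendsto_L
  c := fun s k => if s = r.curvature then ((sch.a k) ^ 4)⁻¹ else 0
  m := fun s k => wilsonTorusMean r.ρ (sch.β k) (sch.L k) s.F

/-- **Canonical curvature `p`-point function** along the scheme at step `k` (product test functions):
the `latticeSchwinger` of the canonically renormalised scheme on curvature strings — the quantity whose
full-sequence convergence is the universality content of (A). -/
def curvNPoint (r : LatticeRep G) (sch : SpeciesScheme (YMSpecies G)) (k p : ℕ) (f : Fin p → 𝓢(𝔼, ℝ)) : ℝ :=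
  latticeSchwinger r.ρ (canon r sch) (fun s => s.F) k p (fun _ => r.curvature) f

/-- **Canonical curvature `p`-point DISTRIBUTION** along the scheme at step `k`, on a general complex test
function `F` of `p` points (the finite lattice sum `∫ ∑ₓ F(a_k x⃗) ∏ᵢ (c a⁴ (P(τ_{xᵢ}U) − m)) dμ_k` with the
canonical `c a⁴ = a⁻⁴ a⁴`): on product tensors it is `curvNPoint` (proved inside the OS-legs stub), and it is the
functional on which E0'-bounds, asymptotic Euclidean invariance and the non-degeneracy witnesses are stated. -/
def curvDistribution (r : LatticeRep G) (sch : SpeciesScheme (YMSpecies G)) (k p : ℕ)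
    (F : 𝓢((Fin p → 𝔼), ℂ)) : ℂ :=
  ∫ U, ∑ x : Fin p → ↥(box 4 (sch.L k)), F (fun i => sch.a k • siteToE (↑(x i) : Site 4)) *
      ∏ i, ((((sch.a k) ^ 4)⁻¹ * sch.a k ^ 4 *
        (r.curvature.F (configShift (-(↑(x i) : Site 4)) (torusLift (sch.side k) U)) -
          wilsonTorusMean r.ρ (sch.β k) (sch.L k) r.curvature.F) : ℝ) : ℂ)
    ∂(wilsonMeasure (d := 4) (L := sch.side k) r.ρ (sch.β k))

/-- **E0'-type uniform bounds** (OS 1975 linear growth, `k`-uniformly): one Schwartz index `s` and constants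
`α, β` bound the canonical curvature distributions on `⁰𝒮` by `α (p!)^β |F|_{p s}`, eventually in `k`. -/
def UVB (r : LatticeRep G) (sch : SpeciesScheme (YMSpecies G)) : Prop :=
  ∃ (s : ℕ) (α β : ℝ), ∀ (p : ℕ) (F : 𝓢((Fin p → 𝔼), ℂ)), IsOffDiagonal F →
    ∀ᶠ k in atTop, ‖curvDistribution r sch k p F‖ ≤ α * (p.factorial : ℝ) ^ β * schwartzNorm (p * s) F

/-- **Asymptotic Euclidean invariance** (E1 in the limit): translating or properly rotating an off-diagonal test
function changes the canonical curvature distributions by `o(1)` as `k → ∞`. -/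
def AsympEuclid (r : LatticeRep G) (sch : SpeciesScheme (YMSpecies G)) : Prop :=
  (∀ (p : ℕ) (F : 𝓢((Fin p → 𝔼), ℂ)), IsOffDiagonal F → ∀ a : 𝔼,
      Tendsto (fun k => curvDistribution r sch k p (translateMulti a F) - curvDistribution r sch k p F)
        atTop (𝓝 0)) ∧
  (∀ (p : ℕ) (F : 𝓢((Fin p → 𝔼), ℂ)), IsOffDiagonal F → ∀ R : 𝔼 ≃ₗᵢ[ℝ] 𝔼,
      LinearMap.det (R.toLinearEquiv : 𝔼 →ₗ[ℝ] 𝔼) = 1 →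
      Tendsto (fun k => curvDistribution r sch k p (linActMulti R F) - curvDistribution r sch k p F)
        atTop (𝓝 0))

/-- **Non-degenerate two-point limit** (the `IsNontrivial` witness at lattice level): a time-ordered pair whose
canonical curvature two-point distribution stays bounded away from `0` (one-point functions vanish identically by
exact centring, so this IS the truncated function). -/
def ND2 (r : LatticeRep G) (sch : SpeciesScheme (YMSpecies G)) : Prop :=
  ∃ (F G₁ : 𝓢((Fin 1 → 𝔼), ℂ)) (H : 𝓢((Fin (1 + 1) → 𝔼), ℂ)),
    IsTimeOrdered F ∧ IsTimeOrdered G₁ ∧ IsAppendTensorOf H (osAdjoint F) G₁ ∧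
      ∃ δ : ℝ, 0 < δ ∧ ∀ᶠ k in atTop, δ ≤ ‖curvDistribution r sch k (1 + 1) H‖

/-- **Non-degenerate three-point limit** (the `IsNonGaussian` witness at lattice level; Disproof §8 kill target
IV′ is its negation): an off-diagonal triple tensor whose canonical curvature three-point distribution stays
bounded away from `0`. -/
def ND3 (r : LatticeRep G) (sch : SpeciesScheme (YMSpecies G)) : Prop :=
  ∃ (f g h : 𝓢(𝔼, ℂ)) (F₃ : 𝓢((Fin 3 → 𝔼), ℂ)), IsTensorOf F₃ ![f, g, h] ∧ IsOffDiagonal F₃ ∧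
    ∃ δ : ℝ, 0 < δ ∧ ∀ᶠ k in atTop, δ ≤ ‖curvDistribution r sch k 3 F₃‖

/-- **Full-sequence convergence on products**: every canonical curvature `p`-point function on an off-diagonal
real product tensor converges along the scheme. (The OUTPUT of the synchronisation engine.) -/
def ConvProducts (r : LatticeRep G) (sch : SpeciesScheme (YMSpecies G)) : Prop :=
  ∀ (p : ℕ), p ≠ 0 → ∀ (f : Fin p → 𝓢(𝔼, ℝ)),
    IsOffDiagonal (SchwartzMap.tensorFin p fun i => ofRealTest (f i)) →
      ∃ c : ℝ, Tendsto (fun k => curvNPoint r sch k p f) atTop (𝓝 c)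

end Vocabulary

/-- **Two-orbit chart** for `(G, r, M)` — HYPOTHESIS STRUCTURE (no existence inside; inhabiting it for all
`M ≥ M₀` is `stub_chart`). It records only what two-orbit synchronisation consumes, ALONG ORBITS OF WILSON POINTS:
chart coordinates `orb g j ∈ ℝ × E` of the effective theory after `j` complete block-spin steps of factor `M`
started from Wilson's action at chart coupling `g` (inverse bare coupling `betaOf g`, onto every large `β`);
parabolic drift of the marginal coordinate while in the window `[0, γ]` (asymptotic freedom, `b > 0`); absorption
of the fibre into the `ρ`-ball after `j₀` steps; the two ORBITWISE DIFFERENCE INEQUALITIES between any two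
in-window small-fibre orbit points (marginal, backward, lossy: `(1 + Cκ γ'²)`; fibre, forward, contracting `θ' < 1`,
with NO additive residue — this is where Lipschitz control of large-field DIFFERENCES is assumed); realised
infinite-volume curvature `n`-point functions `expectInf` with exact covariance, identification with the
thermodynamic limit of centred unit-lattice Wilson `n`-point functions, continuity on the window; the
infinite-volume point-split curvature time-correlator `corrInf` with its PIN (readout non-degeneracy in the
marginal coordinate at some separation `t`, relative fibre slack `ℓ₀ γ'`, depth slack `η → 0`), AF smallness deep
in the window, and the IR-junction field `exit_massive` (exit theories are massive). -/
structure TwoOrbitChart (G : Type) [Group G] [TopologicalSpace G] [IsTopologicalGroup G] [CompactSpace G]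
    [MeasurableSpace G] [BorelSpace G] (r : LatticeRep G) (M : ℕ) where
  /-- the fibre space (irrelevant directions; step-adapted norm allowed, one norm recorded) -/
  E : Type
  [instNormedAddCommGroup : NormedAddCommGroup E]
  [instNormedSpace : NormedSpace ℝ E]
  [instCompleteSpace : CompleteSpace E]
  /-- coupling window `[0, γ]` and small-fibre radius `ρ` -/
  γ : ℝ
  ρ : ℝ
  γ_pos : 0 < γ
  ρ_pos : 0 < ρ
  /-- Wilson dictionary: chart couplings `g ∈ (0, g₀]` ↦ inverse bare coupling `betaOf g`, onto `[B₀, ∞)`,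
  bounded on every `[g₁, g₀]` (so `β → ∞` forces `g → 0⁺`) -/
  g₀ : ℝ
  g₀_pos : 0 < g₀
  g₀_le : g₀ ≤ γ
  betaOf : ℝ → ℝ
  B₀ : ℝ
  betaOf_surj : ∀ β : ℝ, B₀ ≤ β → ∃ g ∈ Set.Ioc (0 : ℝ) g₀, betaOf g = β
  betaOf_bddOn : ∀ g₁ : ℝ, 0 < g₁ → ∃ B : ℝ, ∀ g ∈ Set.Icc g₁ g₀, betaOf g ≤ B
  /-- orbits of Wilson points: `orb g j` = chart coordinates after `j` complete RG steps -/
  orb : ℝ → ℕ → ℝ × E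
  orb_zero : ∀ g : ℝ, (orb g 0).1 = g
  /-- parabolic drift (AF) while the history is in the window -/
  b : ℝ
  b_pos : 0 < b
  drift : ∀ g ∈ Set.Ioc (0 : ℝ) g₀, ∀ j : ℕ, (∀ i ≤ j, (orb g i).1 ≤ γ) →
    (orb g j).1 + b / 2 * (orb g j).1 ^ 3 ≤ (orb g (j + 1)).1 ∧
      (orb g (j + 1)).1 ≤ (orb g j).1 + 2 * b * (orb g j).1 ^ 3
  /-- transient: after `j₀` in-window steps the fibre is inside the `ρ`-ball -/
  j₀ : ℕ
  absorb : ∀ g ∈ Set.Ioc (0 : ℝ) g₀, ∀ j : ℕ, j₀ ≤ j → (∀ i ≤ j, (orb g i).1 ≤ γ) → ‖(orb g j).2‖ ≤ ρ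
  /-- constants of the difference inequalities -/
  θ' : ℝ
  Cκ : ℝ
  C₁ : ℝ
  C₃ : ℝ
  θ'_nonneg : 0 ≤ θ'
  θ'_lt_one : θ' < 1
  Cκ_nonneg : 0 ≤ Cκ
  C₁_nonneg : 0 ≤ C₁
  C₃_nonneg : 0 ≤ C₃
  /-- marginal difference inequality, read BACKWARDS (earlier coupling difference bounded by the later one),
  in the robust lossy form on every sub-window `[0, γ']` -/
  marg_diff : ∀ γ' : ℝ, 0 < γ' → γ' ≤ γ → ∀ g g' : ℝ, g ∈ Set.Ioc (0 : ℝ) g₀ → g' ∈ Set.Ioc (0 : ℝ) g₀ →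
    ∀ j j' : ℕ, (orb g j).1 ∈ Set.Icc 0 γ' → (orb g' j').1 ∈ Set.Icc 0 γ' →
    ‖(orb g j).2‖ ≤ ρ → ‖(orb g' j').2‖ ≤ ρ →
      |(orb g j).1 - (orb g' j').1| ≤
        (1 + Cκ * γ' ^ 2) * |(orb g (j + 1)).1 - (orb g' (j' + 1)).1| +
          C₃ * γ' ^ 3 * ‖(orb g j).2 - (orb g' j').2‖
  /-- fibre difference inequality, read FORWARDS: contraction of fibre DIFFERENCES along two orbits, the coupling
  offset entering with constant `C₁`, and NO additive residue (Lipschitz large-field differences) -/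
  fibre_diff : ∀ γ' : ℝ, 0 < γ' → γ' ≤ γ → ∀ g g' : ℝ, g ∈ Set.Ioc (0 : ℝ) g₀ → g' ∈ Set.Ioc (0 : ℝ) g₀ →
    ∀ j j' : ℕ, (orb g j).1 ∈ Set.Icc 0 γ' → (orb g' j').1 ∈ Set.Icc 0 γ' →
    ‖(orb g j).2‖ ≤ ρ → ‖(orb g' j').2‖ ≤ ρ →
      ‖(orb g (j + 1)).2 - (orb g' (j' + 1)).2‖ ≤
        θ' * ‖(orb g j).2 - (orb g' j').2‖ + C₁ * |(orb g j).1 - (orb g' j').1|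
  /-- realised infinite-volume curvature `n`-point functions of the effective theory at a chart point -/
  expectInf : ℝ × E → (n : ℕ) → (Fin n → 𝓢(𝔼, ℝ)) → ℝ
  /-- exact RG covariance along orbits: one step = block dilation of the test functions -/
  expect_step : ∀ g ∈ Set.Ioc (0 : ℝ) g₀, ∀ (j n : ℕ) (f : Fin n → 𝓢(𝔼, ℝ)),
    expectInf (orb g (j + 1)) n f = expectInf (orb g j) n fun i => blockDilate M (f i)
  /-- identification: at a Wilson point the realised values are the thermodynamic limits of the centred
  unit-lattice Wilson curvature `n`-point functions (unit normalisation) -/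
  expect_wilson : ∀ g ∈ Set.Ioc (0 : ℝ) g₀, ∀ (n : ℕ) (f : Fin n → 𝓢(𝔼, ℝ)),
    Tendsto (fun L : ℕ => wilsonCentredSchwinger r.ρ (betaOf g) L (fun _ => 1) n (fun _ => r.curvature) f)
      atTop (𝓝 (expectInf (orb g 0) n f))
  /-- continuity of the realised off-diagonal `n`-point functions (and of their block dilates) on the
  small-fibre window `[0, γ] × B̄_ρ` -/
  continuousOn_expect : ∀ (n m : ℕ) (f : Fin n → 𝓢(𝔼, ℝ)),
    IsOffDiagonal (SchwartzMap.tensorFin n fun i => ofRealTest (f i)) →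
      ContinuousOn (fun p : ℝ × E => expectInf p n fun i => (blockDilate M)^[m] (f i))
        (Set.Icc 0 γ ×ˢ Metric.closedBall (0 : E) ρ)
  /-- infinite-volume point-split curvature time-correlator `⟨P ; τ_t P⟩_{betaOf g, ∞}` -/
  corrInf : ℝ → ℕ → ℝ
  corr_tendsto : ∀ g ∈ Set.Ioc (0 : ℝ) g₀, ∀ t : ℕ,
    Tendsto (fun S : ℕ => latticeConnectedCorr r.ρ (betaOf g) (2 * S + 1) r.curvature.F r.curvature.F t)
      atTop (𝓝 (corrInf g t))
  /-- relative fibre slack of the pin -/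
  ℓ₀ : ℝ
  ℓ₀_nonneg : 0 ≤ ℓ₀
  /-- THE PIN: at offset `m`, on terminal couplings in `[g_low, γ']` (deep, small fibre, in-window history) some
  separation `t` makes the dimensionless readout `(M^{J+m})⁸ corrInf g (t M^{J+m})` injective in the marginal
  coordinate up to a RELATIVE fibre slack `ℓ₀ γ'` and a depth slack `η(min J J') → 0` -/
  pin : ∀ (m : ℕ) (g_low γ' : ℝ), 0 < g_low → 0 < γ' → γ' ≤ γ →
    ∃ t : ℕ, 0 < t ∧ ∃ c_r : ℝ, 0 < c_r ∧ ∃ η : ℕ → ℝ, Tendsto η atTop (𝓝 0) ∧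
      ∀ g g' : ℝ, g ∈ Set.Ioc (0 : ℝ) g₀ → g' ∈ Set.Ioc (0 : ℝ) g₀ → ∀ J J' : ℕ, j₀ ≤ J → j₀ ≤ J' →
        (∀ i ≤ J, (orb g i).1 ≤ γ') → (∀ i ≤ J', (orb g' i).1 ≤ γ') →
        g_low ≤ (orb g J).1 → g_low ≤ (orb g' J').1 → ‖(orb g J).2‖ ≤ ρ → ‖(orb g' J').2‖ ≤ ρ →
          c_r * |(orb g J).1 - (orb g' J').1| ≤
            |((M : ℝ) ^ (J + m)) ^ 8 * corrInf g (t * M ^ (J + m)) -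
                ((M : ℝ) ^ (J' + m)) ^ 8 * corrInf g' (t * M ^ (J' + m))| +
              c_r * (ℓ₀ * γ') * ‖(orb g J).2 - (orb g' J').2‖ + η (min J J')
  /-- asymptotic-freedom smallness of the readout deep in the window -/
  uv_small : ∀ (m t : ℕ) (ε : ℝ), 0 < ε → ∃ gε : ℝ, 0 < gε ∧ ∀ g ∈ Set.Ioc (0 : ℝ) g₀, ∀ J : ℕ, j₀ ≤ J →
    (∀ i ≤ J, (orb g i).1 ≤ γ) → (orb g J).1 ≤ gε →
      |((M : ℝ) ^ (J + m)) ^ 8 * corrInf g (t * M ^ (J + m))| ≤ ε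
  /-- IR junction: the effective theories at the exit of the sub-window `[0, γ']` are massive — their
  dimensionless curvature correlator at `≥ M^{m₀}` blocks is small, uniformly -/
  exit_massive : ∀ γ' : ℝ, 0 < γ' → γ' ≤ γ → ∀ ε : ℝ, 0 < ε → ∃ m₀ : ℕ, ∀ m : ℕ, m₀ ≤ m →
    ∀ g ∈ Set.Ioc (0 : ℝ) g₀, ∀ J : ℕ, j₀ ≤ J → (∀ i ≤ J, (orb g i).1 ≤ γ') → γ' / 2 ≤ (orb g J).1 →
      |((M : ℝ) ^ (J + m)) ^ 8 * corrInf g (1 * M ^ (J + m))| ≤ ε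

namespace TwoOrbitChart

attribute [instance] instNormedAddCommGroup instNormedSpace instCompleteSpace

variable {G : Type} [Group G] [TopologicalSpace G] [IsTopologicalGroup G] [CompactSpace G]
  [MeasurableSpace G] [BorelSpace G] {r : LatticeRep G} {M : ℕ} (𝒞 : TwoOrbitChart G r M)

/-- The dimensionless readout at offset `m`, separation `t`, along the orbit of `g` at depth `J`:
`(M^{J+m})⁸ · ⟨P ; τ_{t M^{J+m}} P⟩_{betaOf g, ∞}` (for `J + m = n_k` it is the infinite-volume version of
the crux's `N_t(k)`). -/
def Rd (m t : ℕ) (g : ℝ) (J : ℕ) : ℝ := ((M : ℝ) ^ (J + m)) ^ 8 * 𝒞.corrInf g (t * M ^ (J + m))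

/-- The small-fibre window region `W = [0, γ] × B̄_ρ` on which continuity is stated. -/
def W : Set (ℝ × 𝒞.E) := Set.Icc 0 𝒞.γ ×ˢ Metric.closedBall (0 : 𝒞.E) 𝒞.ρ

/-- `W` is closed (product of a closed interval and a closed ball). -/
theorem isClosed_W : IsClosed 𝒞.W := isClosed_Icc.prod Metric.isClosed_closedBall

/-- Iterated covariance along an orbit: `J` steps = `J`-fold block dilation of the test functions. -/
theorem expect_iterate {g : ℝ} (hg : g ∈ Set.Ioc (0 : ℝ) 𝒞.g₀) (J n : ℕ) (f : Fin n → 𝓢(𝔼, ℝ)) :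
    𝒞.expectInf (𝒞.orb g J) n f = 𝒞.expectInf (𝒞.orb g 0) n fun i => (blockDilate M)^[J] (f i) := by
  induction J generalizing f with
  | zero => simp
  | succ J ih =>
    rw [𝒞.expect_step g hg J n f, ih]
    congr 1

end TwoOrbitChart

/-- **Stub 1 statement — the abstract synchronisation lemma (the engine), robust lossy form, reversed index.**
`i = 0` is the terminal (matched) step, `i = J` the start of the comparison window; `a i` = marginal difference,
`b i` = fibre difference. Hypotheses: backward marginal inequality with LOSS `(1 + κ)`, `κ ≤ κ₀`, and cross term
`c₃`; forward fibre contraction `θ` with coupling feed `c₁`; dominated splitting `θ (1 + κ₀) < 1` and `c₁ c₃ ≤ ε₀`.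
Conclusion: the terminal fibre difference is controlled by the initial one (exponentially) and by `c₁ ×` the
terminal marginal difference, with constants uniform in `κ ≤ κ₀`, `c₁`, `c₃`. (The card's `TwoOrbitSynchronisation`
with the triage panel's sharpenings: no parabolic gain is used; terminal conclusion only.) -/
def TwoOrbitSync : Prop :=
  ∀ θ κ₀ : ℝ, 0 ≤ θ → 0 ≤ κ₀ → θ * (1 + κ₀) < 1 →
    ∃ ε₀ K θ₁ : ℝ, 0 < ε₀ ∧ 0 ≤ K ∧ 0 ≤ θ₁ ∧ θ₁ < 1 ∧
      ∀ κ c₁ c₃ : ℝ, 0 ≤ κ → κ ≤ κ₀ → 0 ≤ c₁ → 0 ≤ c₃ → c₁ * c₃ ≤ ε₀ →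
        ∀ (J : ℕ) (a b : ℕ → ℝ), (∀ i, 0 ≤ a i) → (∀ i, 0 ≤ b i) →
          (∀ i, i < J → a (i + 1) ≤ (1 + κ) * a i + c₃ * b (i + 1)) →
          (∀ i, i < J → b i ≤ θ * b (i + 1) + c₁ * a (i + 1)) →
            b 0 ≤ K * θ₁ ^ J * b J + K * c₁ * a 0

/-- **Stub 2 statement — the chart exists (HARDEST; the residual crux `C⁺`).** For every compact simple `G` and
lattice representation `r` there is `M₀` such that for every block factor `M ≥ M₀` (`M ≥ 2`) the two-orbit chart
`TwoOrbitChart G r M` is inhabited. -/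
def ChartExists : Prop :=
  ∀ (G : Type) [Group G] [TopologicalSpace G] [IsTopologicalGroup G] [CompactSpace G]
    [MeasurableSpace G] [BorelSpace G], IsCompactSimpleLieGroup G →
    ∀ r : LatticeRep G, ∃ M₀ : ℕ, ∀ M : ℕ, M₀ ≤ M → 2 ≤ M → Nonempty (TwoOrbitChart G r M)

/-- **Stub 3 statement — orbit anatomy of a tuned sequence (where AF and `θ > 0` are consumed).** Given the chart,
a sub-window `γ'` (with `8 b γ'² ≤ 1`: one drift step is at most `γ'/4`) and Wilson couplings `g k` with
`betaOf (g k) → ∞`, depths `n k → ∞` and infinite-volume tuning `(M^{n_k})⁸ corrInf (g k) (M^{n_k}) → θ > 0`: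
there are a UNIFORM offset `m`, a floor `g_low > 0` and terminal steps `J k → ∞` with `J k + m = n k`, `j₀ ≤ J k`,
the history through `J k` inside `[0, γ']`, fibres in the `ρ`-ball from `j₀` on, and terminal coupling `≥ g_low`.
Mechanism: drift counting (`g k → 0⁺` by `betaOf_bddOn`), `exit_massive` bounds `n k −` (exit step), `uv_small`
bounds the terminal coupling below; covers UV-root (`m` = the IR excess, terminal deep in the window) and IR-root
tunings alike. -/
def Anatomy : Prop :=
  ∀ (G : Type) [Group G] [TopologicalSpace G] [IsTopologicalGroup G] [CompactSpace G]
    [MeasurableSpace G] [BorelSpace G] (r : LatticeRep G) (M : ℕ) (𝒞 : TwoOrbitChart G r M) (γ' : ℝ),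
    0 < γ' → γ' ≤ 𝒞.γ → 8 * 𝒞.b * γ' ^ 2 ≤ 1 →
    ∀ (θ : ℝ) (g : ℕ → ℝ) (n : ℕ → ℕ), 0 < θ →
      (∀ᶠ k in atTop, g k ∈ Set.Ioc (0 : ℝ) 𝒞.g₀) →
      Tendsto (fun k => 𝒞.betaOf (g k)) atTop atTop → Tendsto n atTop atTop →
      Tendsto (fun k => ((M : ℝ) ^ n k) ^ 8 * 𝒞.corrInf (g k) (M ^ n k)) atTop (𝓝 θ) →
        ∃ (m : ℕ) (g_low : ℝ) (J : ℕ → ℕ), 0 < g_low ∧ Tendsto J atTop atTop ∧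
          ∀ᶠ k in atTop, J k + m = n k ∧ 𝒞.j₀ ≤ J k ∧
            (∀ i ≤ J k, (𝒞.orb (g k) i).1 ∈ Set.Icc 0 γ') ∧
            (∀ i, 𝒞.j₀ ≤ i → i ≤ J k → ‖(𝒞.orb (g k) i).2‖ ≤ 𝒞.ρ) ∧
            g_low ≤ (𝒞.orb (g k) (J k)).1

/-- **Stub 4 statement — finite-size independence (the volume leg, lattice-only).** Along an `M`-adic Wilson
scheme with `β_k → ∞` and a volume-uniform lattice gap: (a) the canonical curvature `p`-point functions on the
scheme's torus `2L_k+1` agree, uniformly over all tori `2L+1 ≥ 2L_k+1`, with the unit-normalised centred Wilson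
`p`-point functions with `n_k`-fold block-dilated test functions, up to `o(1)` (at `L = L_k` this is an exact
identity: `c a⁴ = 1`, `f(a_k x) = (blockDilate M)^[n_k] f (x)`); (b) the same for the SCALED point-split
correlators `(M^{n_k})⁸ ⟨P ; τ_{t M^{n_k}} P⟩`. Content: finite-size corrections at physical volume
`a_k(2L_k+1) → ∞` are `o(1)` relative to the physical amplitudes (gap ⇒ `O(e^{−Δ · a_k L_k})`). -/
def VolumeIndependence : Prop :=
  ∀ (G : Type) [Group G] [TopologicalSpace G] [IsTopologicalGroup G] [CompactSpace G]
    [MeasurableSpace G] [BorelSpace G] (r : LatticeRep G) (M : ℕ) (sch : SpeciesScheme (YMSpecies G))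
    (n : ℕ → ℕ) (Δ : ℝ), 0 < Δ → (∀ k, sch.a k = ((M : ℝ) ^ n k)⁻¹) → Tendsto sch.β atTop atTop →
    HasLatticeMassGap r sch Δ →
    (∀ (p : ℕ) (f : Fin p → 𝓢(𝔼, ℝ)), IsOffDiagonal (SchwartzMap.tensorFin p fun i => ofRealTest (f i)) →
      ∀ ε : ℝ, 0 < ε → ∀ᶠ k in atTop, ∀ L : ℕ, sch.L k ≤ L →
        |curvNPoint r sch k p f -
            wilsonCentredSchwinger r.ρ (sch.β k) L (fun _ => 1) p (fun _ => r.curvature)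
              (fun i => (blockDilate M)^[n k] (f i))| ≤ ε) ∧
    (∀ t : ℕ, 0 < t → ∀ ε : ℝ, 0 < ε → ∀ᶠ k in atTop, ∀ S : ℕ, sch.L k ≤ S →
      ((M : ℝ) ^ n k) ^ 8 *
        |latticeConnectedCorr r.ρ (sch.β k) (sch.side k) r.curvature.F r.curvature.F (t * M ^ n k) -
          latticeConnectedCorr r.ρ (sch.β k) (2 * S + 1) r.curvature.F r.curvature.F (t * M ^ n k)| ≤ ε)

/-- **Stub 5 statement — regularity and non-degeneracy of the limits (the UV facts every line owes).** Along a
crux-admissible sequence (compact simple `G`; `M`-adic, `β_k → ∞`, towers convergent, tuned with `θ > 0`, gapped)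
whose canonical curvature `p`-point functions converge on products: `k`-uniform E0' bounds (`UVB`), asymptotic
Euclidean invariance (`AsympEuclid`: the E1 burden, `RegularisationDichotomy`; Disproof §7), a non-degenerate
time-ordered two-point limit (`ND2`, from `θ > 0` + UV stability of the point-split kernel) and a non-degenerate
off-diagonal three-point limit (`ND3`: AF ⇒ the limit of `tr F²` is not Gaussian; Disproof §8 target IV′). -/
def LimitRegularity : Prop :=
  ∀ (G : Type) [Group G] [TopologicalSpace G] [IsTopologicalGroup G] [CompactSpace G]
    [MeasurableSpace G] [BorelSpace G], IsCompactSimpleLieGroup G →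
    ∀ (r : LatticeRep G) (M : ℕ) (θ Δ : ℝ) (sch : SpeciesScheme (YMSpecies G)) (n : ℕ → ℕ),
    0 < θ → 0 < Δ → (∀ k, sch.a k = ((M : ℝ) ^ n k)⁻¹) → Tendsto sch.β atTop atTop →
    (∀ t : ℕ, 0 < t → ∃ c : ℝ, Tendsto (fun k => ((M : ℝ) ^ n k) ^ 8 *
      latticeConnectedCorr r.ρ (sch.β k) (sch.side k) r.curvature.F r.curvature.F (t * M ^ n k))
        atTop (𝓝 c)) →
    Tendsto (fun k => ((M : ℝ) ^ n k) ^ 8 *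
      latticeConnectedCorr r.ρ (sch.β k) (sch.side k) r.curvature.F r.curvature.F (M ^ n k))
        atTop (𝓝 θ) →
    HasLatticeMassGap r sch Δ → ConvProducts r sch →
      UVB r sch ∧ AsympEuclid r sch ∧ ND2 r sch ∧ ND3 r sch

/-- **Stub 6 statement — one-field OS legs (soft packaging).** Full-sequence convergence on off-diagonal real
product tensors + `k`-uniform E0' bounds + asymptotic Euclidean invariance + the two non-degeneracy witnesses + a
volume-uniform lattice gap ⇒ OS data `T` over ALL species (the zero-extension of the one-field family: every
string containing a non-curvature species has identically vanishing canonical lattice functions) with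
`IsYangMillsFor r (canon r sch) T`, `T.IsNontrivial r.curvature`, `T.IsNonGaussian r.curvature`. Internal plan:
Banach–Steinhaus on `⁰𝒮` (products are total), E0 (normalisation; one-point functions vanish by exact centring),
E2 from reflection positivity of Wilson's measure on odd tori passing to the limit, E3, E4 from the gap
(transfer-matrix reading), E1 and E0' from the hypotheses. -/
def OneFieldOSLegs : Prop :=
  ∀ (G : Type) [Group G] [TopologicalSpace G] [IsTopologicalGroup G] [CompactSpace G]
    [MeasurableSpace G] [BorelSpace G] (r : LatticeRep G) (sch : SpeciesScheme (YMSpecies G)) (Δ : ℝ),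
    0 < Δ → HasLatticeMassGap r sch Δ → ConvProducts r sch → UVB r sch → AsympEuclid r sch →
    ND2 r sch → ND3 r sch →
      ∃ T : OSData (YMSpecies G) 4,
        IsYangMillsFor r (canon r sch) T ∧ T.IsNontrivial r.curvature ∧ T.IsNonGaussian r.curvature

section Glue

/-- **Transfer of a limit along eventual `ε`-closeness**: if `u → c` and `v` is eventually `ε`-close to `u`
for every `ε > 0`, then `v → c` (registered glue of the skeleton's composition `stubsImplyCrux`). -/
theorem tendsto_of_forall_eventually_abs_sub_le :
    ∀ {u v : ℕ → ℝ} {c : ℝ}, Tendsto u atTop (𝓝 c) →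
      (∀ ε : ℝ, 0 < ε → ∀ᶠ k in atTop, |v k - u k| ≤ ε) → Tendsto v atTop (𝓝 c) := by
  intro u v c hu h
  rw [Metric.tendsto_nhds] at hu ⊢
  intro ε hε
  filter_upwards [hu (ε / 2) (half_pos hε), h (ε / 2) (half_pos hε)] with k hk1 hk2
  rw [Real.dist_eq] at hk1 ⊢
  calc |v k - c| = |(v k - u k) + (u k - c)| := by ring_nf
    _ ≤ |v k - u k| + |u k - c| := abs_add_le _ _
    _ < ε := by linarith

/-- **A bound uniform over a tail of a convergent sequence passes to its limit** (registered glue of the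
skeleton's composition: finite-size bounds at all tori `L ≥ L₀` pass to the thermodynamic limit). -/
theorem abs_sub_le_of_uniform :
    ∀ {w : ℕ → ℝ} {x l ε : ℝ} {L₀ : ℕ}, Tendsto w atTop (𝓝 l) →
      (∀ L : ℕ, L₀ ≤ L → |x - w L| ≤ ε) → |x - l| ≤ ε := by
  intro w x l ε L₀ hw h
  exact le_of_tendsto ((tendsto_const_nhds.sub hw).abs) (eventually_atTop.2 ⟨L₀, h⟩)

end Glue

end Summit.QuantumFields.YangMills.Cruxes.ContinuumLimitOnTrajectory.TwoOrbitSynchronisation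

end
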